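import Mathlib.Analysis.SpecialFunctions.Pow.Real
import Mathlib.Analysis.Complex.Exponential
import HarnessLib

/-!
# Elementary «eventually in k» inequalities for the top-shell assembly (BAND line)

RH ladder column JENSEN, rung J-P(P3) «log band», BAND crux `XiDerivBandRealAllRates` of route
«JensenLogBand», line «band-one-window» (u-arc, top-shell reshape), lead rh-jensen-prover g8.
RH-FREE real analysis: the bookkeeping that turns the explicit error terms of the window lemma
(`LogBandArc.norm_xiSqArcU_sub_arcMainTerm_le`) — `O(1/k)`, `O(η/√k)`, `k·e^{−bk}` — into «`≤ ε/√k`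
for `k ≥ k₀`». WHAT THIS IS NOT: nothing here bears on zeros of `ζ` or the truth of RH.

* `eventually_sq_mul_exp_neg_le`: `A·k²·e^{−bk} ≤ ε` for `k ≥ k₀(A,b,ε)` (`b, ε > 0`; via `x⁴/4! ≤ eˣ`);
* `eventually_const_mul_sqrt_le`: `C·√k ≤ k` for `k ≥ k₀(C)`.
(`1 − cos x ≥ x²/4` and `log 2 ≤ 1` are in the tree: `Literature.Analysis.InverseSpectral.sq_div_four_le_one_sub_cos`,
`Literature.Probability.LatticeModels.log_two_le_one`.)
-/

noncomputable section

-- single-problem summit: `Summit.RiemannHypothesis.RiemannHypothesis.…` is the tree convention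
set_option linter.dupNamespace false

namespace Summit.RiemannHypothesis.RiemannHypothesis.Theorems.JensenPolynomials.LogBandArc

/-- **`A·k²·e^{−bk} ≤ ε` eventually** (`b, ε > 0`; any `A`). [folklore] -/
theorem eventually_sq_mul_exp_neg_le {A b ε : ℝ} (hb : 0 < b) (hε : 0 < ε) :
    ∃ k₀ : ℕ, ∀ k : ℕ, k₀ ≤ k → A * (k : ℝ) ^ 2 * Real.exp (-(b * k)) ≤ ε := by
  -- `A k² e^{−bk} ≤ |A| k² · 24/(bk)⁴ = 24|A|/(b⁴ k²) ≤ 24|A|/(b⁴ k) ≤ ε` once `k ≥ 24|A|/(b⁴ ε)`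
  obtain ⟨N, hN⟩ := exists_nat_ge (24 * |A| / (b ^ 4 * ε))
  refine ⟨max N 1, fun k hk => ?_⟩
  have hk1 : (1 : ℝ) ≤ k := by exact_mod_cast le_trans (le_max_right _ _) hk
  have hkN : (N : ℝ) ≤ k := by exact_mod_cast le_trans (le_max_left _ _) hk
  have hk0 : (0 : ℝ) < k := by linarith
  have hbk : 0 < b * k := mul_pos hb hk0
  -- `e^{−x} ≤ 24/x⁴` for `x = bk > 0` (from `x⁴/4! ≤ eˣ`)
  have h1 : Real.exp (-(b * k)) ≤ 24 / (b * k) ^ 4 := by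
    have h := Real.pow_div_factorial_le_exp (b * k) hbk.le 4
    have h4 : ((Nat.factorial 4 : ℕ) : ℝ) = 24 := by norm_num [Nat.factorial]
    rw [h4] at h
    rw [Real.exp_neg, inv_eq_one_div, div_le_div_iff₀ (Real.exp_pos _) (by positivity)]
    nlinarith
  have hA : A * (k : ℝ) ^ 2 * Real.exp (-(b * k)) ≤ |A| * (k : ℝ) ^ 2 * Real.exp (-(b * k)) := by
    have : 0 ≤ (k : ℝ) ^ 2 * Real.exp (-(b * k)) := by positivity
    nlinarith [le_abs_self A]
  refine hA.trans ?_
  have h2 : |A| * (k : ℝ) ^ 2 * Real.exp (-(b * k)) ≤ |A| * (k : ℝ) ^ 2 * (24 / (b * k) ^ 4) :=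
    mul_le_mul_of_nonneg_left h1 (by positivity)
  refine h2.trans ?_
  have h3 : |A| * (k : ℝ) ^ 2 * (24 / (b * k) ^ 4) = 24 * |A| / (b ^ 4 * (k : ℝ) ^ 2) := by
    field_simp
  rw [h3, div_le_iff₀ (by positivity)]
  have h4 : 24 * |A| / (b ^ 4 * ε) ≤ k := hN.trans hkN
  rw [div_le_iff₀ (by positivity)] at h4
  have h5 : (k : ℝ) ≤ (k : ℝ) ^ 2 := by nlinarith
  have hb4 : 0 < b ^ 4 * ε := by positivity
  nlinarith [mul_le_mul_of_nonneg_left h5 hb4.le]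

/-- **`C·√k ≤ k` eventually.** [folklore] -/
theorem eventually_const_mul_sqrt_le (C : ℝ) :
    ∃ k₀ : ℕ, ∀ k : ℕ, k₀ ≤ k → C * Real.sqrt k ≤ k := by
  obtain ⟨N, hN⟩ := exists_nat_ge (C ^ 2)
  refine ⟨N, fun k hk => ?_⟩
  have hkN : (N : ℝ) ≤ k := by exact_mod_cast hk
  have hk0 : (0 : ℝ) ≤ k := Nat.cast_nonneg k
  have hsq : Real.sqrt k * Real.sqrt k = k := Real.mul_self_sqrt hk0
  have hs0 : 0 ≤ Real.sqrt k := Real.sqrt_nonneg _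
  rcases le_or_gt C 0 with hC | hC
  · nlinarith
  · -- `C ≤ √k` since `C² ≤ k`
    have hC' : C ≤ Real.sqrt k := by
      rw [show C = Real.sqrt (C ^ 2) by rw [Real.sqrt_sq hC.le]]
      exact Real.sqrt_le_sqrt (hN.trans hkN)
    nlinarith

end Summit.RiemannHypothesis.RiemannHypothesis.Theorems.JensenPolynomials.LogBandArc

end
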